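import Literature.MathematicalPhysics.QuantumLattice.HubbardTorusFluxGauge
import Literature.MathematicalPhysics.QuantumLattice.BdGBondHamiltonian
import Literature.MathematicalPhysics.QuantumLattice.HubbardLSMFillingProofs
import HarnessLib

/-!
# Gauge covariance of the magnetic Hubbard torus; gauge invariance of its sector energies

Topic `Literature/MathematicalPhysics/QuantumLattice` (family `hubbard`). The companion announced in
`MagneticHubbardTorus.lean` ("gauge covariance `H_{A^g} = W_gᴴ H_A W_g` and the resulting gauge
invariance of the sector energies") and in `HubbardTorusFluxGauge.lean` ("NOT here: the operator
identity … and the equality of the sector energies of `hubbardTorusFlux L U θ` and of the uniformly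
twisted torus"). Everything here is PROVED; no definitions, no named facts.

## Contents

* The unitary group of site-phase transformations `W_g = phaseGauge g` (`g : Λ → U(1)`):
  `phaseGauge_mul`, `phaseGauge_conjTranspose` (`W_gᴴ = W_{g⁻¹}`),
  `conjTranspose_phaseGauge_mul_self`, `phaseGauge_mul_conjTranspose_self`,
  `phaseGauge_mem_unitaryGroup`; its diagonal action `phaseGauge_mulVec_apply` and the invariance of
  every joint sector `(N, S^z = M)` (`phaseGauge_mulVec_mem_szSector`).
* Abstract: a unitary `W` mapping a subspace `K` into itself (together with `Wᴴ`) leaves the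
  sector energy invariant, `minEnergyOn (Wᴴ A W) K = minEnergyOn A K`
  (`Matrix.minEnergyOn_conjTranspose_mul_mul`; the Rayleigh-quotient bookkeeping
  `Matrix.star_mulVec_dotProduct_mulVec` is REUSED from `HubbardLSMFillingProofs`).
* **Gauge covariance** of the Peierls-coupled Hubbard torus (Lieb 1994, remark before eq. (1);
  Koma–Tasaki 1992, eqs. (5)–(8)): for `g : (ℤ/L)² → U(1)` and every gauge field `A`,
  `W_g H_A W_gᴴ = H_{gaugeTransform g⁻¹ A}` and `H_{gaugeTransform g A} = W_gᴴ H_A W_g`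
  (`phaseGauge_mul_magneticHubbardTorus_mul_conjTranspose`, `magneticHubbardTorus_gaugeTransform`),
  whence the **gauge invariance of the sector energies** `minEnergyOn_szSector_gaugeTransform`.
* Appended: gauge images of sector ground states (`isGroundStateInSector_phaseGauge_conj_iff`,
  `isGroundStateInSector_gaugeTransform_iff`, `isGroundStateInSector_gaugeTransform_one_iff`).
* Corollaries: PURE GAUGES ARE ISOSPECTRAL — `H_{dθ} := H_{gaugeTransform g 1}` is unitarily
  equivalent to `hubbardTorus 2 L t U` (`L ≥ 3`) and has the same energy in every sector
  (`magneticHubbardTorus_gaugeTransform_one`, `minEnergyOn_szSector_gaugeTransform_one`); the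
  UNIFORM TWIST and the SEAM FLUX have the same sector energies (`L ≥ 2`,
  `minEnergyOn_szSector_uniformTwistConfig`), so the flux envelope of route `FluxSpectroscopy` is
  also the sector energy of the uniformly twisted torus (`fluxEnergy_eq_minEnergyOn_uniformTwistConfig`,
  `L ≥ 3`; Watanabe 2019 §2.2.3: `U_m† H U_m = H^{(2πm/L,…)}`).

## References

* E. H. Lieb, PRL 73 (1994) 2158, gauge-invariance remark before eq. (1). [Lieb1994]
* T. Koma, H. Tasaki, PRL 68 (1992) 3248, eqs. (5)–(8) (site gauge transformations). [KomaTasakiPRL1992]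
* H. Watanabe, J. Stat. Phys. 177 (2019) 717, §2.2.1–§2.2.3, §4.1 (twist operator, seam vs.
  uniform twist). [Watanabe2019]
* Y. Tada, T. Koma, J. Stat. Phys. 165 (2016) 455, §4 (`A' = A ∓ θ` under `e^{iθ n_u}`). [TadaKoma2016]
-/

noncomputable section

open Matrix Finset
open scoped ComplexConjugate

/-! ### Unitary conjugation leaves sector energies invariant (abstract) -/

namespace Matrix

variable {m : Type*} [Fintype m] [DecidableEq m]

/-- (Dot-notation extension of Mathlib's `Matrix`.) **Unitary invariance of sector energies**: if
`W` is unitary and both `W` and `Wᴴ` map the subspace `K` into itself, then `Wᴴ A W` and `A` have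
the same lowest variational energy on `K` (the two Rayleigh sets coincide under `ψ ↦ W ψ`;
`Matrix.star_mulVec_dotProduct_mulVec`, `Matrix.star_mulVec_dotProduct_self_of_unitary` of
`HubbardLSMFillingProofs`). Tasaki (2020) §2.2 (variational characterisation). [folklore] -/
theorem minEnergyOn_conjTranspose_mul_mul (A W : Matrix m m ℂ)
    (K : Submodule ℂ (m → ℂ)) (hW : Wᴴ * W = 1) (hW' : W * Wᴴ = 1)
    (hK : ∀ ψ ∈ K, W *ᵥ ψ ∈ K) (hK' : ∀ ψ ∈ K, Wᴴ *ᵥ ψ ∈ K) :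
    (Wᴴ * A * W).minEnergyOn K = A.minEnergyOn K := by
  have hV : ∀ v, Wᴴ *ᵥ (W *ᵥ v) = v := fun v => by rw [mulVec_mulVec, hW, one_mulVec]
  have hV' : ∀ v, (Wᴴ)ᴴ *ᵥ (Wᴴ *ᵥ v) = v := fun v => by
    rw [conjTranspose_conjTranspose, mulVec_mulVec, hW', one_mulVec]
  unfold Matrix.minEnergyOn
  congr 1
  ext E
  constructor
  · rintro ⟨ψ, hψ, h1, rfl⟩
    refine ⟨W *ᵥ ψ, hK ψ hψ, by rw [star_mulVec_dotProduct_self_of_unitary hV, h1], ?_⟩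
    rw [star_mulVec_dotProduct_mulVec]
  · rintro ⟨φ, hφ, h1, rfl⟩
    refine ⟨Wᴴ *ᵥ φ, hK' φ hφ, by rw [star_mulVec_dotProduct_self_of_unitary hV', h1], ?_⟩
    rw [star_mulVec_dotProduct_mulVec, conjTranspose_conjTranspose]
    congr 3
    calc A = (W * Wᴴ) * A * (W * Wᴴ) := by rw [hW', Matrix.one_mul, Matrix.mul_one]
      _ = W * (Wᴴ * A * W) * Wᴴ := by noncomm_ring

end Matrix

namespace Literature.MathematicalPhysics.QuantumLattice

open Literature.MathematicalPhysics.QuantumFieldTheory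

/-! ### The unitary group of site-phase transformations -/

section PhaseGaugeGroup

variable {Λ : Type*} [LinearOrder Λ]

/-- `W_g W_h = W_{gh}`: the site-phase transformations form a representation of the gauge group
`(Λ → U(1))`. Koma–Tasaki, PRL 68 (1992) 3248, eq. (5). [cite: KomaTasakiPRL1992, eq. (5)] -/
theorem phaseGauge_mul [Fintype Λ] (g h : Λ → Circle) :
    phaseGauge g * phaseGauge h = phaseGauge (g * h) := by
  rw [phaseGauge, phaseGauge, phaseGauge, diagonal_mul_diagonal]
  congr 1
  funext s
  rw [← Circle.coe_mul, ← Finset.prod_mul_distrib]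
  rfl

/-- `W_gᴴ = W_{g⁻¹}` (the phases have unit modulus). [cite: KomaTasakiPRL1992, eq. (5)] -/
theorem phaseGauge_conjTranspose (g : Λ → Circle) : (phaseGauge g)ᴴ = phaseGauge g⁻¹ := by
  rw [phaseGauge, phaseGauge, diagonal_conjTranspose]
  congr 1
  funext s
  rw [Pi.star_apply, Complex.star_def, ← Circle.coe_inv_eq_conj, ← Finset.prod_inv_distrib]
  rfl

/-- `W_gᴴ W_g = 1`. [cite: KomaTasakiPRL1992, eq. (5)] -/
theorem conjTranspose_phaseGauge_mul_self [Fintype Λ] (g : Λ → Circle) :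
    (phaseGauge g)ᴴ * phaseGauge g = 1 := by
  rw [phaseGauge_conjTranspose, phaseGauge_mul, inv_mul_cancel, phaseGauge_one]

/-- `W_g W_gᴴ = 1`. [cite: KomaTasakiPRL1992, eq. (5)] -/
theorem phaseGauge_mul_conjTranspose_self [Fintype Λ] (g : Λ → Circle) :
    phaseGauge g * (phaseGauge g)ᴴ = 1 := by
  rw [phaseGauge_conjTranspose, phaseGauge_mul, mul_inv_cancel, phaseGauge_one]

/-- `W_g` is a unitary matrix. [cite: KomaTasakiPRL1992, eq. (5)] -/
theorem phaseGauge_mem_unitaryGroup [Fintype Λ] (g : Λ → Circle) :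
    phaseGauge g ∈ Matrix.unitaryGroup (Finset (Orb Λ)) ℂ := by
  rw [Matrix.mem_unitaryGroup_iff']
  exact conjTranspose_phaseGauge_mul_self g

/-- `W_g` acts diagonally in the occupation basis: `(W_g ψ)(s) = (∏_{(x,σ) ∈ s} g x) ψ(s)`.
Koma–Tasaki, PRL 68 (1992) 3248, eq. (5). [cite: KomaTasakiPRL1992, eq. (5)] -/
theorem phaseGauge_mulVec_apply [Fintype Λ] (g : Λ → Circle) (ψ : Fock (Orb Λ))
    (s : Finset (Orb Λ)) :
    (phaseGauge g *ᵥ ψ) s = ((∏ o ∈ s, g (ofLex o).1 : Circle) : ℂ) * ψ s := by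
  rw [phaseGauge, mulVec_diagonal]

/-- **Gauge transformations preserve every joint sector `(N, S^z = M)`** (they are diagonal in the
occupation basis, as are `N` and `S^z`). Koma–Tasaki, PRL 68 (1992) 3248, after eq. (5).
[cite: KomaTasakiPRL1992, eq. (5)] -/
theorem phaseGauge_mulVec_mem_szSector [Fintype Λ] (g : Λ → Circle) {N : ℕ} {M : ℝ}
    {ψ : Fock (Orb Λ)} (h : ψ ∈ szSector N M) : phaseGauge g *ᵥ ψ ∈ szSector N M := by
  rw [mem_szSector_iff] at h ⊢
  obtain ⟨hN, hZ⟩ := h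
  refine ⟨fun s hs => by rw [phaseGauge_mulVec_apply, hN s hs, mul_zero], ?_⟩
  funext s
  have hs := congrFun hZ s
  rw [LiebThm1.spinZ_mulVec_apply, Pi.smul_apply, smul_eq_mul] at hs ⊢
  rw [phaseGauge_mulVec_apply]
  linear_combination ((∏ o ∈ s, g (ofLex o).1 : Circle) : ℂ) * hs

/-- `Wᴴ_g` preserves the joint sectors as well. [cite: KomaTasakiPRL1992, eq. (5)] -/
theorem phaseGauge_conjTranspose_mulVec_mem_szSector [Fintype Λ] (g : Λ → Circle) {N : ℕ} {M : ℝ}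
    {ψ : Fock (Orb Λ)} (h : ψ ∈ szSector N M) : (phaseGauge g)ᴴ *ᵥ ψ ∈ szSector N M := by
  rw [phaseGauge_conjTranspose]
  exact phaseGauge_mulVec_mem_szSector _ h

/-- **Sector energies are invariant under site-phase conjugation**: for every operator `H` on Fock
space and every `g : Λ → U(1)`, `minEnergyOn (W_gᴴ H W_g) (N, M) = minEnergyOn H (N, M)`.
[cite: KomaTasakiPRL1992, eq. (5)] -/
theorem minEnergyOn_szSector_phaseGauge_conj [Fintype Λ] (g : Λ → Circle)
    (H : Matrix (Finset (Orb Λ)) (Finset (Orb Λ)) ℂ) (N : ℕ) (M : ℝ) :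
    ((phaseGauge g)ᴴ * H * phaseGauge g).minEnergyOn (szSector N M) =
      H.minEnergyOn (szSector N M) :=
  Matrix.minEnergyOn_conjTranspose_mul_mul H (phaseGauge g) _ (conjTranspose_phaseGauge_mul_self g)
    (phaseGauge_mul_conjTranspose_self g) (fun _ h => phaseGauge_mulVec_mem_szSector g h)
    fun _ h => phaseGauge_conjTranspose_mulVec_mem_szSector g h

end PhaseGaugeGroup

/-! ### Gauge covariance of the magnetic Hubbard torus -/

section Torus

variable {L : ℕ} [NeZero L]

/-- **Gauge covariance of the Peierls Hamiltonian**: conjugating `H_A` by the site-phase unitary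
of `g : (ℤ/L)² → U(1)` (transported to the fermionic torus along `toTorusSite`) multiplies the
amplitude of the hop `x → x + eᵢ` by `g(x+eᵢ) conj g(x)`, i.e. replaces `A` by
`gaugeTransform g⁻¹ A`: `W_g H_A(t,U) W_gᴴ = H_{gaugeTransform g⁻¹ A}(t,U)`; the interaction is
gauge invariant. Lieb, PRL 73 (1994) 2158 (before eq. (1)); Koma–Tasaki, PRL 68 (1992) 3248,
eqs. (7)–(8). [cite: Lieb1994, eq. (1)] -/
theorem phaseGauge_mul_magneticHubbardTorus_mul_conjTranspose (g : Site 2 L → Circle)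
    (A : GaugeConfig 2 L Circle) (t U : ℝ) :
    phaseGauge (fun u : FermionTorus 2 L => g u.toTorusSite) * magneticHubbardTorus L A t U *
        (phaseGauge fun u : FermionTorus 2 L => g u.toTorusSite)ᴴ =
      magneticHubbardTorus L (gaugeTransform g⁻¹ A) t U := by
  have hnum : ∀ y : FermionTorus 2 L,
      phaseGauge (fun u : FermionTorus 2 L => g u.toTorusSite) * (numberOp y 0 * numberOp y 1) *
        (phaseGauge fun u : FermionTorus 2 L => g u.toTorusSite)ᴴ = numberOp y 0 * numberOp y 1 := by
    intro y
    rw [phaseGauge_mul_mul_mul_conjTranspose, phaseGauge_mul_numberOp_mul_conjTranspose,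
      phaseGauge_mul_numberOp_mul_conjTranspose]
  unfold magneticHubbardTorus
  rw [Matrix.mul_add, Matrix.add_mul, Matrix.mul_smul, Matrix.smul_mul, Matrix.mul_smul,
    Matrix.smul_mul, Finset.mul_sum, Finset.sum_mul, Finset.mul_sum, Finset.sum_mul]
  simp only [hnum]
  congr 2
  refine Finset.sum_congr rfl fun x _ => ?_
  rw [Finset.mul_sum, Finset.sum_mul]
  refine Finset.sum_congr rfl fun i _ => ?_
  rw [Finset.mul_sum, Finset.sum_mul]
  refine Finset.sum_congr rfl fun σ _ => ?_
  rw [Matrix.mul_add, Matrix.add_mul, Matrix.mul_smul, Matrix.smul_mul, Matrix.mul_smul,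
    Matrix.smul_mul, phaseGauge_mul_mul_mul_conjTranspose, phaseGauge_mul_creation_mul_conjTranspose,
    phaseGauge_mul_annihilation_mul_conjTranspose, smul_mul_smul, smul_smul,
    phaseGauge_mul_mul_mul_conjTranspose, phaseGauge_mul_creation_mul_conjTranspose,
    phaseGauge_mul_annihilation_mul_conjTranspose, smul_mul_smul, smul_smul]
  simp only [FermionTorus.toTorusSite_ofTorusSite, gaugeTransform, Pi.inv_apply, inv_inv,
    Circle.coe_mul, Circle.coe_inv_eq_conj, map_mul, Complex.conj_conj]
  congr 2
  · simp only [Site.shift]; ring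
  · simp only [Site.shift]; ring

/-- **`H_{A^g} = W_gᴴ H_A W_g`**: the magnetic Hubbard torus in the gauge-transformed field
`gaugeTransform g A` (`(x,i) ↦ g(x) A(x,i) g(x+eᵢ)⁻¹`) is the conjugate of `H_A` by the unitary
site-phase transformation `W_g`. Lieb, PRL 73 (1994) 2158 (gauge-invariance remark before
eq. (1)). [cite: Lieb1994, eq. (1)] -/
theorem magneticHubbardTorus_gaugeTransform (g : Site 2 L → Circle) (A : GaugeConfig 2 L Circle)
    (t U : ℝ) :
    magneticHubbardTorus L (gaugeTransform g A) t U =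
      (phaseGauge fun u : FermionTorus 2 L => g u.toTorusSite)ᴴ * magneticHubbardTorus L A t U *
        phaseGauge fun u : FermionTorus 2 L => g u.toTorusSite := by
  have h := phaseGauge_mul_magneticHubbardTorus_mul_conjTranspose g⁻¹ A t U
  rw [inv_inv] at h
  have h1 : (fun u : FermionTorus 2 L => g u.toTorusSite)⁻¹ = fun u => g⁻¹ u.toTorusSite := rfl
  have h2 : (fun u : FermionTorus 2 L => g⁻¹ u.toTorusSite)⁻¹ = fun u => g u.toTorusSite := by
    funext u; simp only [Pi.inv_apply, inv_inv]
  rw [← h, phaseGauge_conjTranspose, phaseGauge_conjTranspose, h1, h2]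

/-- **Gauge invariance of the sector energies**: `H_{A^g}` and `H_A` have the same lowest energy
in every joint sector `(N, S^z = M)`. Lieb, PRL 73 (1994) 2158 ("the spectrum of `H` depends on
the phases only through the fluxes"). [cite: Lieb1994, eq. (1)] -/
theorem minEnergyOn_szSector_gaugeTransform (g : Site 2 L → Circle) (A : GaugeConfig 2 L Circle)
    (t U : ℝ) (N : ℕ) (M : ℝ) :
    (magneticHubbardTorus L (gaugeTransform g A) t U).minEnergyOn (szSector N M) =
      (magneticHubbardTorus L A t U).minEnergyOn (szSector N M) := by
  rw [magneticHubbardTorus_gaugeTransform]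
  exact minEnergyOn_szSector_phaseGauge_conj _ _ N M

/-- **Pure gauges are unitarily trivial** (`L ≥ 3`): the torus in the pure-gauge field
`dg := gaugeTransform g 1` (`(x,i) ↦ g(x) g(x+eᵢ)⁻¹`, e.g. `e^{i(θ_x − θ_{x+eᵢ})}`) is
`W_gᴴ · hubbardTorus 2 L t U · W_g`. Lieb, PRL 73 (1994) 2158 ("trivial gauge transformation
`c_x ↦ e^{iθ} c_x`"). [cite: Lieb1994, eq. (1)] -/
theorem magneticHubbardTorus_gaugeTransform_one (hL : 3 ≤ L) (g : Site 2 L → Circle) (t U : ℝ) :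
    magneticHubbardTorus L (gaugeTransform g 1) t U =
      (phaseGauge fun u : FermionTorus 2 L => g u.toTorusSite)ᴴ * hubbardTorus 2 L t U *
        phaseGauge fun u : FermionTorus 2 L => g u.toTorusSite := by
  rw [magneticHubbardTorus_gaugeTransform, magneticHubbardTorus_one_eq_hubbardTorus hL]

/-- **Pure gauges are isospectral in every sector** (`L ≥ 3`):
`minEnergyOn H_{dg} (N, M) = minEnergyOn (hubbardTorus 2 L t U) (N, M)`. [cite: Lieb1994, eq. (1)] -/
theorem minEnergyOn_szSector_gaugeTransform_one (hL : 3 ≤ L) (g : Site 2 L → Circle) (t U : ℝ)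
    (N : ℕ) (M : ℝ) :
    (magneticHubbardTorus L (gaugeTransform g 1) t U).minEnergyOn (szSector N M) =
      (hubbardTorus 2 L t U).minEnergyOn (szSector N M) := by
  rw [minEnergyOn_szSector_gaugeTransform, magneticHubbardTorus_one_eq_hubbardTorus hL]

/-- **Uniform twist versus seam flux, operator level** (`L ≥ 2`): the uniformly twisted torus
(phase `e^{iθ/L}` on every `e₁`-edge) is the conjugate of the seam-flux torus by the
Lieb–Schultz–Mattis twist `W = phaseGauge (twistGauge L θ)`. Watanabe, J. Stat. Phys. 177 (2019)
717, §2.2.3 (`U_m† H U_m = H^{(2πm/L,…,2πm/L)}`). [cite: Watanabe2019, §2.2.3 and §4.1] -/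
theorem magneticHubbardTorus_uniformTwistConfig (hL : 2 ≤ L) (θ t U : ℝ) :
    magneticHubbardTorus L (uniformTwistConfig L θ) t U =
      (phaseGauge fun u : FermionTorus 2 L => twistGauge L θ u.toTorusSite)ᴴ *
        magneticHubbardTorus L (seamFluxConfig L θ) t U *
        phaseGauge fun u : FermionTorus 2 L => twistGauge L θ u.toTorusSite := by
  rw [← gaugeTransform_twistGauge_seamFluxConfig hL, magneticHubbardTorus_gaugeTransform]

/-- **Uniform twist versus seam flux, sector energies** (`L ≥ 2`): spreading the flux `θ`
uniformly over the `e₁`-bonds or concentrating it on the seam gives the same lowest energy in every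
joint sector `(N, S^z = M)`. Watanabe (2019) §2.2.3. [cite: Watanabe2019, §2.2.3 and §4.1] -/
theorem minEnergyOn_szSector_uniformTwistConfig (hL : 2 ≤ L) (θ t U : ℝ) (N : ℕ) (M : ℝ) :
    (magneticHubbardTorus L (uniformTwistConfig L θ) t U).minEnergyOn (szSector N M) =
      (magneticHubbardTorus L (seamFluxConfig L θ) t U).minEnergyOn (szSector N M) := by
  rw [← gaugeTransform_twistGauge_seamFluxConfig hL, minEnergyOn_szSector_gaugeTransform]

/-- **The flux-threaded torus is unitarily equivalent to the uniformly twisted torus** (`L ≥ 3`):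
`H_{uniform twist θ} = Wᴴ (hubbardTorusFlux L U θ) W` with `W` the Lieb–Schultz–Mattis twist.
Watanabe (2019) §2.2.3, §4.1. [cite: Watanabe2019, §2.2.3 and §4.1] -/
theorem magneticHubbardTorus_uniformTwistConfig_eq_conj_hubbardTorusFlux (hL : 3 ≤ L) (U θ : ℝ) :
    magneticHubbardTorus L (uniformTwistConfig L θ) 1 U =
      (phaseGauge fun u : FermionTorus 2 L => twistGauge L θ u.toTorusSite)ᴴ *
        hubbardTorusFlux L U θ *
        phaseGauge fun u : FermionTorus 2 L => twistGauge L θ u.toTorusSite := by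
  rw [magneticHubbardTorus_uniformTwistConfig (by omega), hubbardTorusFlux_eq_magneticHubbardTorus hL]

/-- **The flux envelope through the uniform twist** (`L ≥ 3`): the flux envelope
`fluxEnergy L U δ θ` of route `FluxSpectroscopy` (lowest energy of the seam-twisted torus in the
sector `N_L = 2⌊(1-δ)L²/2⌋`, `S^z = 0`) equals the same sector energy of the uniformly twisted
Peierls torus. Watanabe (2019) §2.2.3, §4.1; Scalapino–White–Zhang (1993). [cite: Watanabe2019, §2.2.3 and §4.1] -/
theorem fluxEnergy_eq_minEnergyOn_uniformTwistConfig (hL : 3 ≤ L) (U δ θ : ℝ) :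
    fluxEnergy L U δ θ =
      (magneticHubbardTorus L (uniformTwistConfig L θ) 1 U).minEnergyOn
        (szSector (2 * ⌊(1 - δ) * (L : ℝ) ^ 2 / 2⌋₊) 0) := by
  rw [fluxEnergy_eq_minEnergyOn_magneticHubbardTorus hL,
    minEnergyOn_szSector_uniformTwistConfig (by omega)]

end Torus

/-! ### Gauge images of sector ground states (appended) -/

section GroundStates

variable {Λ : Type*} [LinearOrder Λ] [Fintype Λ]

/-- The site-phase unitary is injective on vectors: `W_g ψ = 0 → ψ = 0`. [cite: KomaTasakiPRL1992, eq. (5)] -/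
theorem phaseGauge_mulVec_eq_zero_iff (g : Λ → Circle) (ψ : Fock (Orb Λ)) :
    phaseGauge g *ᵥ ψ = 0 ↔ ψ = 0 := by
  constructor
  · intro h
    have h' := congrArg (fun v => (phaseGauge g)ᴴ *ᵥ v) h
    simpa only [mulVec_mulVec, conjTranspose_phaseGauge_mul_self, one_mulVec, mulVec_zero] using h'
  · rintro rfl; exact mulVec_zero _

/-- **Gauge images of sector ground states are sector ground states of the conjugated operator**:
`ψ` is a ground state of `W_gᴴ H W_g` in the joint sector `(N, S^z = M)` iff `W_g ψ` is one of `H`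
(the sector, the sector energy and the eigen-equation are all transported by the sector-preserving
unitary `W_g`). Koma–Tasaki, PRL 68 (1992) 3248, eqs. (5)–(8). [cite: KomaTasakiPRL1992, eq. (5)] -/
theorem isGroundStateInSector_phaseGauge_conj_iff (g : Λ → Circle)
    (H : Matrix (Finset (Orb Λ)) (Finset (Orb Λ)) ℂ) (N : ℕ) (M : ℝ) (ψ : Fock (Orb Λ)) :
    IsGroundStateInSector ((phaseGauge g)ᴴ * H * phaseGauge g) N M ψ ↔
      IsGroundStateInSector H N M (phaseGauge g *ᵥ ψ) := by
  unfold IsGroundStateInSector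
  rw [minEnergyOn_szSector_phaseGauge_conj, Ne, Ne, phaseGauge_mulVec_eq_zero_iff]
  have hWW := conjTranspose_phaseGauge_mul_self (Λ := Λ) g
  have hWW' := phaseGauge_mul_conjTranspose_self (Λ := Λ) g
  constructor
  · rintro ⟨hmem, hne, heig⟩
    refine ⟨phaseGauge_mulVec_mem_szSector g hmem, hne, ?_⟩
    have h := congrArg (fun v => phaseGauge g *ᵥ v) heig
    simp only [mulVec_mulVec, mulVec_smul] at h
    rwa [← Matrix.mul_assoc, ← Matrix.mul_assoc, hWW', Matrix.one_mul, ← mulVec_mulVec] at h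
  · rintro ⟨hmem, hne, heig⟩
    refine ⟨?_, hne, ?_⟩
    · have h := phaseGauge_conjTranspose_mulVec_mem_szSector g hmem
      rwa [mulVec_mulVec, hWW, one_mulVec] at h
    · rw [← mulVec_mulVec, ← mulVec_mulVec, heig, mulVec_smul, mulVec_mulVec, hWW, one_mulVec]

variable {L : ℕ} [NeZero L]

/-- **Gauge covariance of sector ground states of the magnetic torus**: `ψ` is a sector ground state
of `H_{A^g}` iff `W_g ψ` is one of `H_A`. Lieb, PRL 73 (1994) 2158. [cite: Lieb1994, eq. (1)] -/
theorem isGroundStateInSector_gaugeTransform_iff (g : Site 2 L → Circle) (A : GaugeConfig 2 L Circle)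
    (t U : ℝ) (N : ℕ) (M : ℝ) (ψ : Fock (Orb (FermionTorus 2 L))) :
    IsGroundStateInSector (magneticHubbardTorus L (gaugeTransform g A) t U) N M ψ ↔
      IsGroundStateInSector (magneticHubbardTorus L A t U) N M
        (phaseGauge (fun u : FermionTorus 2 L => g u.toTorusSite) *ᵥ ψ) := by
  rw [magneticHubbardTorus_gaugeTransform]
  exact isGroundStateInSector_phaseGauge_conj_iff _ _ N M ψ

/-- **Pure gauges act on the ground states of the Hubbard torus** (`L ≥ 3`): `ψ` is a sector ground
state of the pure-gauge torus `H_{dg}` iff its gauge image `W_g ψ` is a sector ground state of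
`hubbardTorus 2 L t U` — the gauge orbit of a ground state consists of ground states of the gauged
Hamiltonians. Lieb, PRL 73 (1994) 2158; Koma–Tasaki (1992). [cite: Lieb1994, eq. (1)] -/
theorem isGroundStateInSector_gaugeTransform_one_iff (hL : 3 ≤ L) (g : Site 2 L → Circle) (t U : ℝ)
    (N : ℕ) (M : ℝ) (ψ : Fock (Orb (FermionTorus 2 L))) :
    IsGroundStateInSector (magneticHubbardTorus L (gaugeTransform g 1) t U) N M ψ ↔
      IsGroundStateInSector (hubbardTorus 2 L t U) N M
        (phaseGauge (fun u : FermionTorus 2 L => g u.toTorusSite) *ᵥ ψ) := by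
  rw [isGroundStateInSector_gaugeTransform_iff, magneticHubbardTorus_one_eq_hubbardTorus hL]

end GroundStates

end Literature.MathematicalPhysics.QuantumLattice
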